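import Summits.HodgeConjecture.HodgeConjecture.Theses.SupersingularIsotypicLift
import Literature.AlgebraicGeometry.HodgeTheory.ComplexGysinCorrespondence

/-!
# Birth skeleton (BC3) for crux `HodgeClassesEnveloped` (stmt-HodgeConjecture-3049) —
# route `SupersingularIsotypicLift`, line `birth`: REACH ∧ SEMISIMPLE ∧ UNIT ⟹ ENV
# ("the Hodge-valued ideal of the correspondence algebra has a unit")

Crux (FIXED, the route decl, not restated):
`Summit.HodgeConjecture.HodgeConjecture.Theses.SupersingularIsotypicLift.HodgeClassesEnveloped` =
ENV: for every orientation family `μ` with Poincaré duality, every smooth projective complex `X`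
(`dim X = n`), every `p` and every RATIONAL class `c ∈ H²ᵖ(X(ℂ); ℂ)` of Hodge type `(p,p)` there is
`γ ∈ algebraicClasses (X ⊗ X) n` whose correspondence action `P_γ β = pr₁₊(pr₂^* β ∪ γ)`
(`pr₁₊ = complexGysin μ`) (i) preserves rational classes, (ii) has image of type `(p,p)`, and
(iii) fixes `c`.

Observation making the line possible (this file, `act_apply`, `rfl`): the route's inline `P_γ` IS
the tree's named bilinear action `corrAction μ hX hX rfl γ` (`HodgeTheory/ComplexGysinCorrespondence`,
Voisin II (10.7)), so `P_γ` is LINEAR in `γ` and in `β` and the actions `P_γ`, `γ` algebraic, generate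
a finite-dimensional `ℂ`-algebra `R = corrAlgebra μ hX p ⊆ End_ℂ H²ᵖ(X(ℂ); ℂ)` — the image of the
algebra of codimension-`n` algebraic self-correspondences of `X` (modulo homological equivalence,
`⊗ ℂ`; independent of `μ`, which only rescales `P_γ` by a unit, `corrAction_eq_smul_of_orientationFamily`).
Call `γ` HODGE-VALUED (`IsHodgeValued`) when it satisfies exactly the crux's (i)+(ii) and is algebraic.
The Hodge-valued actions span a TWO-SIDED IDEAL `I` of `R` (algebraic correspondences map rational
Hodge classes to rational Hodge classes), and ENV says: every Hodge class is fixed by an element of `I`.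

LINE (Jannsen/Kleiman semisimplicity + Jacobson density; MurreTorino1994 Thm. 7.8 = Jannsen1992;
BourbakiAlgebreVIII2012 VIII §4 no.5 Thm. 3):

  ENV ⟸ REACH ∧ SEMISIMPLE ∧ (SEMISIMPLE ⟹ UNIT),

* `stub_hodgeClassesReached` (REACH, the Hodge-theoretic half; OPEN, load-bearing): every rational
  `(p,p)`-class lies in the SPAN of the images `im P_γ`, `γ` Hodge-valued (`reachedClasses`). Implied by
  ENV (`c = P_γ c`; in-file `hodgeClassesReached_of_crux`, sorry-free) and by HC (an algebraic `c` is
  reached by the rank-one correspondence `pr₁^*c ∪ pr₂^*h^{n-p}`); strictly weaker than ENV in the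
  absence of idempotents in `I` — it asks that Hodge classes be REACHED by Hodge-valued algebraic
  correspondences, not FIXED.
* `stub_correspondenceAlgebraSemisimple` (SEMISIMPLE, the cycle-theoretic half; OPEN in general,
  KNOWN for abelian varieties): the algebra `R` is semisimple. It is a quotient of
  `CHⁿ(X × X)_ℚ/hom ⊗ ℂ`, hence semisimple as soon as hom = num on `X × X` (Jannsen 1992 = Murre
  Thm. 7.8 (3); standard conjecture `D(X × X)`, which over `ℂ` follows from `B(X)`, Lieberman 1968 —
  so KNOWN for abelian varieties, products of curves and surfaces, flag varieties).
* `stub_leftUnit_of_semisimple` (UNIT from SEMISIMPLE; PROVABLE NOW in print, L-sized in the tree):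
  if `R` is semisimple, the ideal `I` has a left unit: some Hodge-valued `γ` with
  `P_γ ∘ P_γ' = P_γ'` for every Hodge-valued `γ'`. Proof in print: `V := I·H ⊆ Hdg` is stable under
  `R` and under the commutant `R'`; `R` semisimple ⟹ `R'` semisimple ⟹ `V` has an `R'`-stable
  complement; the projector `e` onto `V` along it commutes with `R'`, so `e ∈ R'' = R` by Jacobson's
  density theorem (Bourbaki VIII §4 no.5 Thm. 3, `H` finite-dimensional); `im e = V ⊆ Hdg` puts `e`
  in `I` (defined over `ℚ`: `R = R_ℚ ⊗ ℂ`, `I = I_ℚ ⊗ ℂ`, rescale by the orientation unit), and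
  `e|_V = id` gives `e ∘ P_γ' = P_γ'`.

GLUE (`act_apply_eq_self_of_mem_reachedClasses`, REAL proof, no `sorry`; `HodgeClassesEnveloped_of` is the
A12-shape skeleton theorem — the ONLY theorem of the file concluding the crux, no hypotheses, `sorry` only
through the three `stub_*`): with `e = P_γ` the unit,
`reachedClasses ≤ eqLocus(P_γ, id)` (`iSup₂_le` over the generators `P_γ' b`, `P_γ (P_γ' b) = P_γ' b`),
so `P_γ c = c` for every reached `c`, in particular (REACH) for every rational `(p,p)`-class; `γ` is
algebraic, rational-preserving and `(p,p)`-imaged by construction — the crux BY NAME (the inline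
`let P := …` of the route decl is `act μ hX p γ` definitionally).

The picture (given UNIT): `Algᵖ(X)_ℂ ⊆ Reachᵖ(X) := reachedClasses ⊆ Hdgᵖ(X)_ℚ ⊗ ℂ` — every algebraic
class is reached (rank-one correspondences), every reached class is a combination of rational Hodge
classes (Hodge-valued actions). HC is both equalities; this crux ENV is the RIGHT equality
`Reach = Hdg` (plus the idempotent), and the route's sibling crux LIFT (`IsotypicClassesAlgebraic`:
fixed ⟹ algebraic) is the LEFT one `Reach ∩ H_ℚ ⊆ Alg`. The line therefore decomposes ENV without
touching LIFT's side.

Why this cut and not André's (Hodge ⟹ motivated) ∧ B: that pair is route `MotivatedLefschetzSplit`'s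
crux set (`HodgeClassesMotivated`, `LefschetzStandardB`) and jointly gives HC itself, i.e. it would
prove ENV through HC ⟹ ENV. The present cut stays at ENV-strength: REACH ∧ UNIT ⟹ ENV ⟹ REACH, and
UNIT/SEMISIMPLE carry exactly the idempotent that distinguishes "fixed" from "reached"; for abelian
varieties SEMISIMPLE is Lieberman's theorem, so there ENV ⟺ REACH (André 1996 §6.3 Rem. 2 locates the
remaining difficulty in `B` for compact pencils — here it sits in REACH).

Disproof used: none relevant — `ledger crux ls stmt-HodgeConjecture-3049`: "(no workfiles yet)" at
registration (no `Disproof.lean`, no `_false_without_` theorem, no `Negative/` lemma); `ledger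
negatives --problem HodgeConjecture` checked for envelope-type statements (none on ENV).
-/

-- `Summit.<Summit>.<Problem>`: for the single-conjunct summit the duplicate `HodgeConjecture.HodgeConjecture` is mandated.
set_option linter.dupNamespace false

noncomputable section

namespace Summit.HodgeConjecture.HodgeConjecture.Cruxes.HodgeClassesEnveloped.Birth

open CategoryTheory MonoidalCategory
open Literature.AlgebraicGeometry.Motives Literature.AlgebraicGeometry.HodgeTheory
open Literature.AlgebraicTopology.SingularHomology (cupProduct)
open Summit.HodgeConjecture.HodgeConjecture.Theses.SupersingularIsotypicLift (HodgeClassesEnveloped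
  HodgeModels_holds)

variable (μ : OrientationFamily) {n : ℕ} {X : SchemeOver ℂ}

/-! ## The objects of the line (all REAL definitions over existing declarations) -/

/-- **The route's correspondence action, named**: `act μ hX p γ β = pr₁₊(pr₂^* β ∪ γ)` on
`H²ᵖ(X(ℂ); ℂ)` for `γ ∈ H²ⁿ((X ⊗ X)(ℂ); ℂ)`, `pr₁₊ = complexGysin μ` — the tree's bilinear
`corrAction μ hX hX rfl` (linear in `γ` and in `β`). [cite: VoisinHodgeII2003, proof of Thm. 10.17 (10.7)] -/
abbrev act (hX : IsSmoothProjective n X) (p : ℕ) :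
    complexBetti (X ⊗ X) (2 * n) →ₗ[ℂ] complexBetti X (2 * p) →ₗ[ℂ] complexBetti X (2 * p) :=
  corrAction μ hX hX (rfl : 2 * p + 2 * n = 2 * p + 2 * n)

/-- `act` is VERBATIM the inline `P` of the route decls `HodgeClassesEnveloped` /
`IsotypicClassesAlgebraic` (definitional, `rfl`). [cite: VoisinHodgeII2003, proof of Thm. 10.17 (10.7)] -/
theorem act_apply (hX : IsSmoothProjective n X) (p : ℕ) (γ : complexBetti (X ⊗ X) (2 * n))
    (β : complexBetti X (2 * p)) :
    act μ hX p γ β =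
      complexGysin μ (IsSmoothProjective.tensor_holds hX hX) hX (CartesianMonoidalCategory.fst X X)
        (show 2 * p + 2 * n + 2 * n = 2 * p + 2 * (n + n) by ring)
        (cupProduct (rfl : 2 * p + 2 * n = 2 * p + 2 * n)
          (complexBetti.map (CartesianMonoidalCategory.snd X X) (2 * p) β) γ) :=
  rfl

/-- **Hodge-valued correspondence classes in degree `2p`** — exactly the three requirements the
crux puts on `γ`: algebraic of codimension `n` on `X ⊗ X`, `P_γ` preserves rational classes, and
`P_γ` has image of Hodge type `(p,p)`. [cite: Deligne2000, §1] -/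
def IsHodgeValued (hX : IsSmoothProjective n X) (p : ℕ) (γ : complexBetti (X ⊗ X) (2 * n)) : Prop :=
  γ ∈ algebraicClasses (X ⊗ X) n ∧
    (∀ β, IsRationalClass β → IsRationalClass (act μ hX p γ β)) ∧
      ∀ β, IsOfHodgeType n X (2 * p) p p (act μ hX p γ β)

/-- **Reached classes** `V = I·H ⊆ H²ᵖ(X(ℂ); ℂ)`: the span (supremum) of the images of the
Hodge-valued correspondence actions. [cite: Kleiman1968, §1.2] -/
def reachedClasses (hX : IsSmoothProjective n X) (p : ℕ) : Submodule ℂ (complexBetti X (2 * p)) :=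
  ⨆ (γ : complexBetti (X ⊗ X) (2 * n)) (_ : IsHodgeValued μ hX p γ), LinearMap.range (act μ hX p γ)

/-- **The correspondence algebra in degree `2p`**: the `ℂ`-subalgebra of `End_ℂ H²ᵖ(X(ℂ); ℂ)`
generated by the actions `P_γ` of the algebraic classes `γ ∈ Nⁿ H²ⁿ((X ⊗ X)(ℂ); ℂ)` — the image of
the algebra of algebraic self-correspondences of degree `0` modulo homological equivalence, `⊗ ℂ`
(Murre, Torino lectures, §7.10–7.11). [cite: MurreTorino1994, §7.10 Key Lemma and §7.11] -/
def corrAlgebra (hX : IsSmoothProjective n X) (p : ℕ) :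
    Subalgebra ℂ (Module.End ℂ (complexBetti X (2 * p))) :=
  Algebra.adjoin ℂ {f | ∃ γ ∈ algebraicClasses (X ⊗ X) n, f = act μ hX p γ}

/-! ## The three registered stubs (`sorry` lives ONLY here) -/

/-- **STUB 1 — REACH (open; the Hodge-theoretic, load-bearing stub).** Every rational class of Hodge
type `(p,p)` on a smooth projective complex `X` lies in the span of the images of the Hodge-valued
algebraic self-correspondence actions `P_γ` in degree `2p` (`reachedClasses`). Why plausibly true:
implied by the crux (`c = P_γ c`, `hodgeClassesReached_of_crux` below, sorry-free) hence by HC; holds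
for every ALGEBRAIC `c` unconditionally (rank-one correspondence `pr₁^* c ∪ pr₂^* h^{n-p}`, image
`ℂ·c`), for CM abelian varieties and Fermat hypersurfaces (character idempotents of `End`/`Aut`,
Shioda 1979, Pohlmann 1968) and for Weil classes (`ℚ[k^*]`-idempotents). Why it might fail: only with
HC (a non-reached Hodge class is non-algebraic); open where Hodge classes are not reachable from
endomorphism/automorphism algebras (abelian varieties beyond the commutant of `End`, André 1996 §6.3
Rem. 2; general type). Strictly weaker than the crux: "reached", not "fixed" — the idempotent is
STUBS 2–3. Size: open problem. [cite: Andre1996Motifs, §6.3 Remarque 2 (p. 33)]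
[cite: Deligne1982HodgeCycles, p. 62 Remark 6.3] -/
theorem stub_hodgeClassesReached :
    ∀ (μ : OrientationFamily), μ.HasPoincareDuality →
      ∀ ⦃n : ℕ⦄ ⦃X : SchemeOver ℂ⦄ (hX : IsSmoothProjective n X) (p : ℕ)
        (c : complexBetti X (2 * p)), IsRationalClass c → IsOfHodgeType n X (2 * p) p p c →
          c ∈ reachedClasses μ hX p := by
  sorry

/-- **STUB 2 — SEMISIMPLE (open in general; KNOWN for abelian varieties; the cycle-theoretic stub).**
The correspondence algebra `corrAlgebra μ hX p ⊆ End_ℂ H²ᵖ(X(ℂ); ℂ)` is semisimple. Why plausibly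
true: it is a quotient of `CHⁿ(X × X)_ℚ/hom ⊗ ℂ`, and "`A^d(X × X)` is a finite dimensional,
semi-simple `ℚ`-algebra" modulo NUMERICAL equivalence unconditionally (Jannsen 1992; Murre Thm. 7.8 and
Key Lemma 7.10 b), so it is semisimple whenever hom = num for codimension-`n` cycles on `X × X`
(standard conjecture `D(X × X)`; over `ℂ`, `B(X) ⇒ B(X × X) ⇒ D(X × X)`, Lieberman 1968 / Kleiman
1968) — KNOWN for abelian varieties (Lieberman), products of curves and surfaces, flag varieties; a
quotient of a semisimple algebra is semisimple, and `ℚ → ℂ` preserves semisimplicity. Why it might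
fail: only with `D(X × X)` false in codimension `n`, i.e. with `¬B(X)`, i.e. (over `ℂ`) only if HC
fails for `X × X`. Size: open problem (standard-conjecture strength, but for ONE algebra in ONE
degree). [cite: MurreTorino1994, Thm. 7.8 and §7.10–7.11] [cite: Jannsen1992, Thm. 1]
[cite: Lieberman1968, Thm. 1] -/
theorem stub_correspondenceAlgebraSemisimple :
    ∀ (μ : OrientationFamily), μ.HasPoincareDuality →
      ∀ ⦃n : ℕ⦄ ⦃X : SchemeOver ℂ⦄ (hX : IsSmoothProjective n X) (p : ℕ),
        IsSemisimpleRing (corrAlgebra μ hX p) := by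
  sorry

/-- **STUB 3 — UNIT from SEMISIMPLE (provable now in print; L-sized in the tree).** If the
correspondence algebra in degree `2p` is semisimple, the Hodge-valued actions have a LEFT UNIT: a
Hodge-valued `γ` with `P_γ ∘ P_γ' = P_γ'` for every Hodge-valued `γ'`. Proof in print: the
Hodge-valued actions span a two-sided ideal `I` of `R = corrAlgebra` (algebraic correspondences send
rational classes to rational classes up to the orientation unit, `complexGysin_ringChange_eq_smul_gysinMap`,
and `(p,p)`-classes to `(p,p)`-classes, `isOfHodgeType_complexGysin` + cup/pull-back compatibilities);
`V := I·H` is a sub-`R`-module and a sub-`R'`-module (`R'` the commutant); `R` semisimple ⟹ `R'`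
semisimple ⟹ `V` has an `R'`-stable complement, whose projector `e` lies in the bicommutant
`R'' = R` (Jacobson density, `H²ᵖ` finite-dimensional: Bourbaki VIII §4 no.5 Thm. 3) and in `I`
(`im e = V ⊆ Hdg_ℚ ⊗ ℂ`; `e` is defined over `ℚ` since `R = R_ℚ ⊗ ℂ`, `I = I_ℚ ⊗ ℂ`; rescale `γ` by the
orientation unit to make `P_γ = e` rational-preserving), and `e|_V = id` is the claim. Why it might
fail: it does not in print; in the tree it needs `R = span` of the `P_γ` (composition of algebraic
correspondences is algebraic: `corrCompClass_mem_algebraicClasses`, `corr_comp_of_baseChange`),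
universal coefficients `H²ᵖ(X(ℂ); ℚ) ⊗ ℂ = H²ᵖ(X(ℂ); ℂ)` for `IsRationalClass`, and the
Hodge-compatibility of `P_γ`. Size: L. [cite: BourbakiAlgebreVIII2012, VIII §4 no.5 Thm. 3 (Jacobson)]
[cite: MurreTorino1994, §7.11] -/
theorem stub_leftUnit_of_semisimple :
    ∀ (μ : OrientationFamily), μ.HasPoincareDuality →
      ∀ ⦃n : ℕ⦄ ⦃X : SchemeOver ℂ⦄ (hX : IsSmoothProjective n X) (p : ℕ),
        IsSemisimpleRing (corrAlgebra μ hX p) →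
          ∃ γ : complexBetti (X ⊗ X) (2 * n), IsHodgeValued μ hX p γ ∧
            ∀ γ' : complexBetti (X ⊗ X) (2 * n), IsHodgeValued μ hX p γ' →
              act μ hX p γ ∘ₗ act μ hX p γ' = act μ hX p γ' := by
  sorry

/-! ## Glue (sorry-free): a left unit of the Hodge-valued ideal fixes every reached class -/

/-- **The glue lemma.** If `P_γ ∘ P_γ' = P_γ'` for every Hodge-valued `γ'` (a left unit of the
Hodge-valued ideal), then `P_γ` fixes every reached class: `reachedClasses ≤ eqLocus(P_γ, id)` by
`iSup₂_le` over the generators `P_γ' b` (`P_γ (P_γ' b) = P_γ' b`) and linearity. [folklore] -/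
theorem act_apply_eq_self_of_mem_reachedClasses {μ : OrientationFamily} {hX : IsSmoothProjective n X}
    {p : ℕ} {γ : complexBetti (X ⊗ X) (2 * n)}
    (hunit : ∀ γ' : complexBetti (X ⊗ X) (2 * n), IsHodgeValued μ hX p γ' →
      act μ hX p γ ∘ₗ act μ hX p γ' = act μ hX p γ')
    {c : complexBetti X (2 * p)} (hc : c ∈ reachedClasses μ hX p) : act μ hX p γ c = c := by
  have hle : reachedClasses μ hX p ≤ LinearMap.eqLocus (act μ hX p γ) LinearMap.id :=
    iSup₂_le fun γ' hγ' x hx ↦ by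
      obtain ⟨b, rfl⟩ := LinearMap.mem_range.1 hx
      exact LinearMap.congr_fun (hunit γ' hγ') b
  exact hle hc

/-! ## The skeleton theorem: the crux BY NAME from the three declared stubs (no `sorry` here) -/

/-- **THE SKELETON THEOREM.** The crux
`Summit.HodgeConjecture.HodgeConjecture.Theses.SupersingularIsotypicLift.HodgeClassesEnveloped`,
concluded BY NAME from the three declared stubs: SEMISIMPLE (stub 2) feeds UNIT (stub 3), whose
unit `e = P_γ` fixes every reached class (`act_apply_eq_self_of_mem_reachedClasses`), hence (REACH,
stub 1) every rational `(p,p)`-class; `γ` is algebraic, rational-preserving and `(p,p)`-imaged by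
construction, and the route's inline `P` is `act μ hX p γ` definitionally (A12 shape: no
hypotheses, `sorry` only inside `stub_*`). [cite: MurreTorino1994, Thm. 7.8]
[cite: BourbakiAlgebreVIII2012, VIII §4 no.5 Thm. 3 (Jacobson)] -/
theorem HodgeClassesEnveloped_of : HodgeClassesEnveloped := by
  intro μ hμ n X hX p c hc hpp
  obtain ⟨γ, ⟨hγalg, hγrat, hγhdg⟩, hunit⟩ :=
    stub_leftUnit_of_semisimple μ hμ hX p (stub_correspondenceAlgebraSemisimple μ hμ hX p)
  exact ⟨γ, hγalg, hγrat, hγhdg,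
    act_apply_eq_self_of_mem_reachedClasses hunit (stub_hodgeClassesReached μ hμ hX p c hc hpp)⟩

/-! ## Sanity (sorry-free) -/

/-- The crux implies STUB 1 (`c = P_γ c` is reached): REACH is not stronger than ENV, so it is
refutable only where ENV (hence HC) is. [folklore] -/
theorem hodgeClassesReached_of_crux (h : HodgeClassesEnveloped) :
    ∀ (μ : OrientationFamily), μ.HasPoincareDuality →
      ∀ ⦃n : ℕ⦄ ⦃X : SchemeOver ℂ⦄ (hX : IsSmoothProjective n X) (p : ℕ)
        (c : complexBetti X (2 * p)), IsRationalClass c → IsOfHodgeType n X (2 * p) p p c →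
          c ∈ reachedClasses μ hX p := by
  intro μ hμ n X hX p c hc hpp
  obtain ⟨γ, hγalg, hγrat, hγhdg, hfix⟩ := h μ hμ hX p c hc hpp
  exact Submodule.mem_iSup_of_mem γ
    (Submodule.mem_iSup_of_mem ⟨hγalg, hγrat, hγhdg⟩ (LinearMap.mem_range.2 ⟨c, hfix⟩))

/-- The definitions compute: the ZERO correspondence is Hodge-valued (`P_0 = 0` preserves rational
classes and has `(p,p)` image — a Hodge model exists by the route's PROVED support `HodgeModels`), so
`IsHodgeValued`, `reachedClasses` are inhabited-in-kind and STUB 3's conclusion is not vacuous by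
emptiness. [folklore] -/
theorem isHodgeValued_zero (hX : IsSmoothProjective n X) (p : ℕ) : IsHodgeValued μ hX p 0 := by
  obtain ⟨A⟩ := HodgeModels_holds hX
  refine ⟨Submodule.zero_mem _, fun β _ ↦ ?_, fun β ↦ ?_⟩
  · rw [map_zero, LinearMap.zero_apply]
    exact IsRationalClass.zero
  · rw [map_zero, LinearMap.zero_apply]
    exact IsOfHodgeType.zero A (2 * p) p p

/-- The identity of `End H²ᵖ` lies in the correspondence algebra (as in any subalgebra), so
`corrAlgebra` is a unital algebra of operators and STUB 2 is a statement about a genuine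
finite-dimensional algebra. [folklore] -/
theorem one_mem_corrAlgebra (hX : IsSmoothProjective n X) (p : ℕ) :
    (1 : Module.End ℂ (complexBetti X (2 * p))) ∈ corrAlgebra μ hX p :=
  Subalgebra.one_mem _

end Summit.HodgeConjecture.HodgeConjecture.Cruxes.HodgeClassesEnveloped.Birth

end
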